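import Literature.Analysis.ODE.OneSidedComparison
import HarnessLib

/-!
# Fluid computer blueprint — the build-up rung for the drain-conversion stage

HONEST FRAMING: low prior, high value-of-information experiment on Tao's machine paradigm; NOT a
claim that NS blows up. This file is an elementary planar ODE estimate (an observability bound for
a forced rotation with weak damping); nothing is asserted about any fluid equation or about the
threshold gate itself.

## Why

`DrainRotor.lean` shows that, along the rotor angle, the unconverted energy `a² + d²` of the
threshold gate's transfer subsystem decays exponentially once the angle-damping `γ = κã/(rc)` has
reached a floor `γ₀ > 0`. At the start of the transfer window the output `ã` is at leak level, so
`γ ≈ 0`: the damping is BUILT UP by the transfer itself through `dã/dΘ = (κ/(rc))·d² ≥ K₀·d²`.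
This file proves the build-up rung — an OBSERVABILITY estimate: a rotation cannot keep its energy
out of the damped coordinate `d`, so any quantity `Φ` with `Φ' ≥ K₀·d²` grows LINEARLY in angle
after an `O(1)`-radian delay, as long as the damping is still weak (`γ ≤ γ₁ ≤ 2`) and the energy
stays `≥ u₀`:

* `DampedRotor.output_buildup` — for `da/dΘ = -d + p`, `dd/dΘ = a - γ·d + q` with `0 ≤ γ ≤ γ₁ ≤ 2`,
  `|p|, |q| ≤ η`, `|a|, |d| ≤ R`, `a² + d² ≥ u₀` and `Φ' ≥ K₀·d²` (`K₀ ≥ 0`) on the window: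
  `Φ(Θ) ≥ Φ(0) - K₀R² + (K₀/2)·((1 - γ₁/2)·u₀ - 2Rη)·Θ`.

Proof: `Ψ = Φ + (K₀/2)·a·d` has `Ψ' ≥ (K₀/2)(a² + d² - γad + pd + aq)` because
`(ad)' = a² - d² - γad + pd + aq` trades the invisible `a²` for the visible `d²`; then the affine
comparison `mul_le_sub_of_le_deriv_right` (`ODE/OneSidedComparison.lean`). Together with
`DrainRotor.lean` this is the two-phase skeleton (build-up, then exponential conversion) of the
successor's drain-conversion statement (HOME/pub-fluidc-bp3/NEXT-STAGES.md).
[cite: Tao2016AveragedNS, §5.5 (the energy-transfer phase of Thm 5.3)]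
-/

noncomputable section

open Set

namespace Literature.Analysis.FluidPDE.FluidComputer

open Literature.Analysis.ODE

namespace DampedRotor

variable {a d a' d' γ Φ Φ' : ℝ → ℝ} {γ₁ R η K₀ u₀ T : ℝ}

/-- **Output build-up (observability of the rotation).** See the module docstring. [folklore] -/
theorem output_buildup (hac : ContinuousOn a (Icc 0 T)) (hdc : ContinuousOn d (Icc 0 T))
    (hΦc : ContinuousOn Φ (Icc 0 T))
    (ha' : ∀ s ∈ Ico 0 T, HasDerivWithinAt a (a' s) (Ici s) s)
    (hd' : ∀ s ∈ Ico 0 T, HasDerivWithinAt d (d' s) (Ici s) s)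
    (hΦ' : ∀ s ∈ Ico 0 T, HasDerivWithinAt Φ (Φ' s) (Ici s) s)
    (hK₀ : 0 ≤ K₀) (hK : ∀ s ∈ Ico 0 T, K₀ * d s ^ 2 ≤ Φ' s)
    (hγ : ∀ s ∈ Ico 0 T, 0 ≤ γ s ∧ γ s ≤ γ₁) (hγ₁ : γ₁ ≤ 2) (hR : 0 ≤ R) (hη : 0 ≤ η)
    (hab : ∀ s ∈ Icc 0 T, |a s| ≤ R ∧ |d s| ≤ R) (hu : ∀ s ∈ Ico 0 T, u₀ ≤ a s ^ 2 + d s ^ 2)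
    (hp : ∀ s ∈ Ico 0 T, |a' s + d s| ≤ η) (hq : ∀ s ∈ Ico 0 T, |d' s - (a s - γ s * d s)| ≤ η) :
    ∀ Θ ∈ Icc 0 T,
      Φ 0 - K₀ * R ^ 2 + K₀ / 2 * ((1 - γ₁ / 2) * u₀ - 2 * R * η) * Θ ≤ Φ Θ := by
  intro Θ hΘ
  set Ψ : ℝ → ℝ := fun s => Φ s + K₀ / 2 * (a s * d s) with hΨ_def
  set Ψ' : ℝ → ℝ := fun s => Φ' s + K₀ / 2 * (a' s * d s + a s * d' s) with hΨ'_def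
  have hΨc : ContinuousOn Ψ (Icc 0 T) := hΦc.add (continuousOn_const.mul (hac.mul hdc))
  have hΨd : ∀ s ∈ Ico 0 T, HasDerivWithinAt Ψ (Ψ' s) (Ici s) s := fun s hs =>
    (hΦ' s hs).add (((ha' s hs).mul (hd' s hs)).const_mul _)
  have hslope : ∀ s ∈ Ico 0 T, K₀ / 2 * ((1 - γ₁ / 2) * u₀ - 2 * R * η) ≤ Ψ' s := by
    intro s hs
    obtain ⟨hg0, hg1⟩ := hγ s hs
    obtain ⟨haR, hdR⟩ := hab s (Ico_subset_Icc_self hs)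
    set p := a' s + d s with hp_def
    set q := d' s - (a s - γ s * d s) with hq_def
    have hpη : |p| ≤ η := hp s hs
    have hqη : |q| ≤ η := hq s hs
    have ea : a' s = -d s + p := by simp only [hp_def]; ring
    have ed : d' s = a s - γ s * d s + q := by simp only [hq_def]; ring
    -- `|ad| ≤ u/2`, `γ|ad| ≤ γ₁ u/2`
    have had : |a s * d s| ≤ (a s ^ 2 + d s ^ 2) / 2 := by
      rw [abs_le]; constructor <;> nlinarith [sq_nonneg (a s + d s), sq_nonneg (a s - d s)]
    have hγad : γ s * (a s * d s) ≤ γ₁ * ((a s ^ 2 + d s ^ 2) / 2) :=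
      (mul_le_mul_of_nonneg_left (le_abs_self _) hg0).trans
        (mul_le_mul hg1 had (abs_nonneg _) (hg0.trans hg1))
    -- forcing
    have hf1 : -(p * d s) ≤ R * η := by
      have h := neg_le_abs (p * d s); rw [abs_mul] at h
      have h2 : |p| * |d s| ≤ η * R := mul_le_mul hpη hdR (abs_nonneg _) hη
      linarith
    have hf2 : -(a s * q) ≤ R * η := by
      have h := neg_le_abs (a s * q); rw [abs_mul] at h
      exact h.trans (mul_le_mul haR hqη (abs_nonneg q) hR)
    have hus := hu s hs
    have h12 : 0 ≤ 1 - γ₁ / 2 := by linarith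
    have hid : Ψ' s = Φ' s + K₀ / 2 * ((a s ^ 2 + d s ^ 2) - 2 * d s ^ 2 - γ s * (a s * d s) +
        (p * d s) + (a s * q)) := by
      simp only [hΨ'_def, ea, ed]; ring
    have hK2 : 0 ≤ K₀ / 2 := by linarith
    have hcore : (1 - γ₁ / 2) * u₀ - 2 * R * η ≤
        (a s ^ 2 + d s ^ 2) - γ s * (a s * d s) + (p * d s) + (a s * q) := by
      have := mul_le_mul_of_nonneg_left hus h12
      nlinarith [hγad, hf1, hf2, this]
    have hKd := hK s hs
    rw [hid]
    nlinarith [mul_le_mul_of_nonneg_left hcore hK2, hKd, hK2]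
  have hmain := mul_le_sub_of_le_deriv_right hΨc hΨd hslope Θ hΘ
  simp only [hΨ_def, sub_zero] at hmain
  -- `|ad| ≤ R²` at both ends
  have hend : ∀ s ∈ Icc 0 T, |a s * d s| ≤ R ^ 2 := by
    intro s hs
    obtain ⟨haR, hdR⟩ := hab s hs
    rw [abs_mul, sq]; exact mul_le_mul haR hdR (abs_nonneg _) hR
  have h0 := (abs_le.1 (hend 0 ⟨le_rfl, hΘ.1.trans hΘ.2⟩)).1
  have hΘ' := (abs_le.1 (hend Θ hΘ)).2
  have hK2 : 0 ≤ K₀ / 2 := by linarith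
  have h0' := mul_le_mul_of_nonneg_left h0 hK2
  have hΘ'' := mul_le_mul_of_nonneg_left hΘ' hK2
  linarith [hmain, h0', hΘ'']

end DampedRotor

end Literature.Analysis.FluidPDE.FluidComputer

end
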